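/-
Copyright (c) 2026 the pub-hodgecm-mathlib formalisation cell (harness21).  Prover seat hodgecm-mathlib-R90-C14-p02 (g3) (section S6, dealer R90-C14-plan (g2),
card (G1) «E1-DISCHARGE», R90 bus 2026-09-05T03:03:11Z; census `R90/R90-C14-p02/g3/G1-DISCHARGE-CENSUS.md` 7afcecd4, rulings (Q1)(Q2) + «PLAN =» 03:09:36Z; FLSUM pin
03:3xZ).  FILE 3a = the LETTERS the (U0)-discharge builds from typ1's (E1) v2.3 binders.  THEOREMS ONLY (no `def`, no `instance`, no notation, no named-fact hypothesis,
no `sorry`); lane `--supports stmt-HodgeConjecture-24833 --as helper` (count-neutral helper).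
-/
import Summits.HodgeConjecture.HodgeConjecture.Theorems.R90S6EllipticIdentityTypeOneShells       -- ★ FILE 1a p865125 (this seat): `setOf_compression_fixed_eq_ball`, frame opens
import Summits.HodgeConjecture.HodgeConjecture.Theorems.R90S6RegularTreeBallCount                 -- ★ HF1 A0 p864869: `ncard_sphere_eq_of_regular_tree`
import Literature.NumberTheory.Rogawski1990.DepthZeroTransferMatrixIdentity                       -- ★ `Flicker1998.phiH_sub_phiH_pred`; brings `phiH`, `phiOne`, `flicker_theorem15`
import Literature.NumberTheory.Automorphic.UnitaryGroupRankOneBigCell                             -- ★ `UnitaryGroup.exists_coe_eq_diag` (`d(α, β, (σα)⁻¹) ∈ T`)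
import Mathlib.RingTheory.Henselian
import HarnessLib

/-!
# R90 · S6 — CARD (G1) «E1-DISCHARGE», FILE 3a: THE LETTERS OF THE (U0)-DISCHARGE — Hensel square roots (`LocalConjDatum` from the complete unramified datum),
# the `r`-torus of the ★ a₀ frame, the exponent letters and their ultrametric tag, the `φ₁`-slot lemma, and `#Ball(x₀, N) = φ_H(q, N)`
# (`Theorems/R90S6EllipticIdentityTypeOneLetters.lean`)

Cell `hodgecm-mathlib`, crux H413 (`stmt-HodgeConjecture-24833`), route of record `HCCMUnconditional`; programme R90-TF, section S6 (base `R90-C14`), seat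
R90-C14-p02 (g3); card (G1) «E1-DISCHARGE» (dealer R90-C14-plan (g2), 03:03:11Z; rulings 03:09:36Z: «(U0)-deep = FLSUM … pin the ★ Flicker summation»; pinned
03:3xZ: ★ `Flicker1998.flicker_theorem15`).  Consumer: FILE 3b `Theorems/R90S6EllipticIdentityTypeOneUnitLevel.lean` ((U0) in every regime ⇒ (E1) ⟸ (U1)).

THE MATHEMATICS.  typ1's (E1) v2.3 (`4c174fca74d7a58a` :191) carries the ★ a₀ FRAME of FILE 0 (H.1) VERBATIM (`[IsDiscreteValuationRing 𝒪[K]] [IsAdicComplete 𝔪 𝒪[K]]`,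
`y, cW, um, (R, ι, σR, dR, ϖR), hqR, a₀`) but, by ruling (Q2), NOT the letters a discharge file can BUILD: this file builds them.
* §1 `localConjDatum_of_isAdicComplete`: the NON-DYADIC datum `LocalConjDatum σ ϖ` of the ★ a₀ heads from (E1)'s `UnramifiedLocalConjDatum σ ϖ` + `|2| = 1` + completeness
  — the `sqrt` field is Hensel's lemma for `X² − u` at the simple root `1` (Mathlib `IsAdicComplete.henselianRing`).
* §2 `exists_centralizer_coe_eq_diag_zpow`: the torus letters `r i = diag((ϖ^i)⁻¹, 1, ϖ^i) ∈ Z_U(cW)` of the ★ a₀ heads (★ `UnitaryGroup.exists_coe_eq_diag`).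
* §3 residue-field letter: `natCard_residueField_eq_of_card` (`Nat.card 𝓀 = q²`) (`1 < q` is ★ `one_lt_of_card_residueField_eq_sq`, (G2) FILE 2, inlined by the consumer).
* §4 exponent letters: `exists_v_eq_v_pow_of_datum` (`|x| = |ϖ^n|` for non-zero integral `x`) (`a + c − 2b ≠ 0` is ★ `UnitaryGroup.add_sub_two_mul_ne_zero`),
  `flickerSum_two_smallest_eq` (the two smallest of `v(a−b), v(c−b), v(a−c)` agree — ★ `flicker_theorem15`'s tag `h`),
  `phiOne_eq_of_caseTag` (`φ₁(q; N₊, N) = φ₁(q; N₁, N)` under ★ FILE 0 (H.3)'s case tag: `φ₁(q; X, N)` does not see `X` once `N ≤ X`).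
* §5 `ncard_ball_eq_phiH`: on the `(q+1)`-regular tree, `#Ball(x₀, N) = φ_H(q, N) = (q^N(q+1) − 2)∕(q−1)` (★ A0 spheres + ★ `phiH_sub_phiH_pred`), and
  `ncard_compression_fixed_eq_phiH`: `Φ = #Fix(δ₁) = φ_H(q, N)` for `|a − c| = |ϖ^N|` (★ FILE 1a `setOf_compression_fixed_eq_ball`).
HONEST LABEL: letters and bookkeeping over ★ files; proves no printed statement, discharges no citation; count-neutral.  HC_CM is proved only modulo the 7 printed citations
(2 remaining named inputs: hLiu418 = stmt-HodgeConjecture-24832, h413 = stmt-HodgeConjecture-24833) until rung 0 closes; REL ≠ ★ ≠ BUILT.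

## References
* [Flicker1998UnitaryFL] Y. Z. Flicker, *Elementary proof of the fundamental lemma for a unitary group*, Canad. J. Math. 50 (1998): Prop. 11 p. 87, Prop. 14 p. 94,
  §6 Theorem 15 pp. 95–96.
* [Rogawski1990] J. D. Rogawski, *Automorphic Representations of Unitary Groups in Three Variables*, Ann. of Math. Stud. 123 (1990): §4.9 Prop. 4.9.1 (b) pp. 54–55.
* [SerreLocalFields1979] J.-P. Serre, *Local Fields* (1979), Ch. II §4 Prop. 7 (Hensel's lemma).
* [Omeara1963] O. T. O'Meara, *Introduction to Quadratic Forms* (1963), §63A (non-dyadic units and squares).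
* [Serre1980Trees] J.-P. Serre, *Trees* (1980), I.2.3 Ex. 2, II.1.1.
-/

set_option autoImplicit false
-- the mandated namespace repeats the single-problem summit's segment (`HodgeConjecture.HodgeConjecture`)
set_option linter.dupNamespace false

noncomputable section

open MulAction SimpleGraph Finset Polynomial
open scoped Valued WithZero Matrix MatrixGroups
open Literature.NumberTheory.Automorphic Literature.NumberTheory.Automorphic.HermitianLattice Literature.NumberTheory.Automorphic.UnitaryGroup
open Literature.NumberTheory.Rogawski1990.Flicker1998 (phiOne phiH phiH_sub_phiH_pred)
open Literature.Combinatorics.SimpleGraph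

namespace Summit.HodgeConjecture.HodgeConjecture.R90.S6

section Letters

variable {K : Type} [Field K] [Valued K ℤᵐ⁰] {σ : K →+* K} {ϖ : K}

/-! ## §1 The non-dyadic datum from completeness (Hensel square roots) -/

/-- **`LocalConjDatum σ ϖ` FROM THE COMPLETE UNRAMIFIED DATUM**: for `hd : UnramifiedLocalConjDatum σ ϖ` with `|2| = 1` on a field whose valuation ring is
`𝔪`-adically complete, every `1`-unit `u` is the square of a `1`-unit — Hensel's lemma for the monic `X² − u` at its simple residual root `1` (`f(1) = 1 − u ∈ 𝔪`,
`f′(1) = 2 ∈ 𝒪^×`; Mathlib `IsAdicComplete.henselianRing`). [cite: SerreLocalFields1979, Ch. II §4 Prop. 7] [cite: Omeara1963, §63A] -/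
theorem localConjDatum_of_isAdicComplete [IsAdicComplete (IsLocalRing.maximalIdeal 𝒪[K]) 𝒪[K]]
    (hd : UnramifiedLocalConjDatum σ ϖ) (h2 : Valued.v (2 : K) = 1) : LocalConjDatum σ ϖ := by
  refine ⟨hd.σσ, hd.vσ, hd.σϖ, hd.vϖ, h2, fun u hu => ?_⟩
  have hint : (Valued.v (R := K)).Integers 𝒪[K] := Valuation.integer.integers _
  have hvu : Valued.v u = 1 := by
    have : u = 1 + (u - 1) := by ring
    rw [this]; exact Valuation.map_one_add_of_lt _ hu
  obtain ⟨u', hu'⟩ : ∃ u' : 𝒪[K], (u' : K) = u := ⟨⟨u, (Valuation.mem_integer_iff _ _).2 hvu.le⟩, rfl⟩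
  have hmem : ∀ x : 𝒪[K], x ∈ IsLocalRing.maximalIdeal 𝒪[K] ↔ Valued.v (x : K) < 1 := by
    intro x
    rw [IsLocalRing.mem_maximalIdeal, mem_nonunits_iff, hint.isUnit_iff_valuation_eq_one]
    exact ⟨fun h => lt_of_le_of_ne x.2 h, fun h => ne_of_lt h⟩
  have he1 : (X ^ 2 - C u').eval 1 = 1 - u' := by
    rw [eval_sub, eval_pow, eval_X, eval_C, one_pow]
  have he2 : (derivative (X ^ 2 - C u')).eval 1 = 2 := by
    rw [derivative_sub, derivative_C, sub_zero, derivative_X_pow, eval_mul, eval_C, eval_pow, eval_X, one_pow, mul_one]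
    norm_num
  have h1 : (X ^ 2 - C u').eval 1 ∈ IsLocalRing.maximalIdeal 𝒪[K] := by
    rw [he1, hmem, AddSubgroupClass.coe_sub, OneMemClass.coe_one, hu', ← Valuation.map_neg, neg_sub]
    exact hu
  have h2' : IsUnit (Ideal.Quotient.mk (IsLocalRing.maximalIdeal 𝒪[K]) ((derivative (X ^ 2 - C u')).eval 1)) := by
    refine IsUnit.map _ ?_
    rw [he2, hint.isUnit_iff_valuation_eq_one]
    exact h2
  obtain ⟨s, hs, hs1⟩ := HenselianRing.is_henselian (I := IsLocalRing.maximalIdeal 𝒪[K]) (X ^ 2 - C u') (monic_X_pow_sub_C u' two_ne_zero) 1 h1 h2'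
  refine ⟨(s : K), ?_, ?_⟩
  · have h : s ^ 2 = u' := by
      rwa [IsRoot.def, eval_sub, eval_pow, eval_X, eval_C, sub_eq_zero] at hs
    rw [← hu', ← h, SubmonoidClass.coe_pow]
  · have := (hmem _).1 hs1
    rwa [AddSubgroupClass.coe_sub, OneMemClass.coe_one] at this

/-! ## §2 The torus letters `r i = diag((ϖ^i)⁻¹, 1, ϖ^i)` of the ★ a₀ frame -/

/-- **THE `r`-TORUS OF THE ★ a₀ HEADS**: for the unramified datum and `cW = diag(1, −1, 1) ∈ U₃` there is `r : ℕ → Z_U(cW)` with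
`r i = diag((ϖ^i)⁻¹, 1, ϖ^i)` (★ `UnitaryGroup.exists_coe_eq_diag` at `α = (ϖ^i)⁻¹`, `β = 1`: `(σα)⁻¹ = ϖ^i` since `σϖ = ϖ`; diagonal matrices commute).
[cite: Flicker1998UnitaryFL, Prop. 5 p. 82] [cite: Rogawski1990, §4.9 p. 54] -/
theorem exists_centralizer_coe_eq_diag_zpow (hd : UnramifiedLocalConjDatum σ ϖ)
    {cW : ↥(unitaryGroupOfForm σ ((StdForm.antidiagonal 3).over K))} (hcW : ((cW : GL (Fin 3) K) : Matrix (Fin 3) (Fin 3) K) = !![1, 0, 0; 0, -1, 0; 0, 0, 1]) :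
    ∃ r : ℕ → ↥(Subgroup.centralizer ({cW} : Set ↥(unitaryGroupOfForm σ ((StdForm.antidiagonal 3).over K)))),
      ∀ i, (((r i : ↥(unitaryGroupOfForm σ ((StdForm.antidiagonal 3).over K))) : GL (Fin 3) K) : Matrix (Fin 3) (Fin 3) K) =
        !![(ϖ ^ i)⁻¹, 0, 0; 0, 1, 0; 0, 0, ϖ ^ i] := by
  have hϖ0 : ϖ ≠ 0 := CartanUnique.uniformizer_ne_zero hd.vϖ
  have hex : ∀ i : ℕ, ∃ t : ↥(Subgroup.centralizer ({cW} : Set ↥(unitaryGroupOfForm σ ((StdForm.antidiagonal 3).over K)))),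
      (((t : ↥(unitaryGroupOfForm σ ((StdForm.antidiagonal 3).over K))) : GL (Fin 3) K) : Matrix (Fin 3) (Fin 3) K) =
        !![(ϖ ^ i)⁻¹, 0, 0; 0, 1, 0; 0, 0, ϖ ^ i] := by
    intro i
    obtain ⟨t, -, ht⟩ := UnitaryGroup.exists_coe_eq_diag σ (J := (StdForm.antidiagonal 3).over K) rfl hd.σσ (inv_ne_zero (pow_ne_zero i hϖ0))
      (β := (1 : K)) (by rw [map_one, mul_one])
    have hσi : σ (ϖ ^ i)⁻¹ = (ϖ ^ i)⁻¹ := by rw [map_inv₀, map_pow, hd.σϖ]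
    rw [hσi, inv_inv] at ht
    refine ⟨⟨t, ?_⟩, ht⟩
    rw [Subgroup.mem_centralizer_iff]
    rintro h hh
    rw [Set.mem_singleton_iff] at hh
    subst hh
    apply Subtype.ext
    apply Units.ext
    change ((h : GL (Fin 3) K) : Matrix (Fin 3) (Fin 3) K) * ((t : GL (Fin 3) K) : Matrix (Fin 3) (Fin 3) K) =
      ((t : GL (Fin 3) K) : Matrix (Fin 3) (Fin 3) K) * ((h : GL (Fin 3) K) : Matrix (Fin 3) (Fin 3) K)
    rw [hcW, ht]
    ext a b
    fin_cases a <;> fin_cases b <;> simp [Matrix.mul_apply, Fin.sum_univ_three]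
  choose r hr using hex
  exact ⟨r, hr⟩

/-! ## §3 Residue-field letters -/

/-- `Nat.card 𝓀 = q²` from `Fintype.card 𝓀 = q²` (the ★ a₀ heads' spelling). [folklore] -/
theorem natCard_residueField_eq_of_card [Fintype 𝓀[K]] {q : ℕ} (hq : Fintype.card 𝓀[K] = q ^ 2) :
    Nat.card (IsLocalRing.ResidueField 𝒪[K]) = q ^ 2 := by
  rw [Nat.card_eq_fintype_card]; exact hq

/-! ## §4 Exponent letters and their ultrametric tags -/

/-- **`|x| = |ϖ^n|`** for a non-zero integral `x` at an unramified datum (`|ϖ| = exp(−1)`). [folklore] -/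
theorem exists_v_eq_v_pow_of_datum (hd : UnramifiedLocalConjDatum σ ϖ) {x : K} (hx0 : x ≠ 0) (hx : Valued.v x ≤ 1) :
    ∃ n : ℕ, Valued.v x = Valued.v (ϖ ^ n) := by
  have h0 : Valued.v x ≠ 0 := (Valuation.ne_zero_iff _).2 hx0
  have hlog : WithZero.log (Valued.v x) ≤ 0 := by
    rw [WithZero.log_le_iff_le_exp h0, WithZero.exp_zero]; exact hx
  refine ⟨(-WithZero.log (Valued.v x)).toNat, ?_⟩
  rw [map_pow, hd.vϖ, ← WithZero.exp_nsmul, nsmul_eq_mul, Int.toNat_of_nonneg (by omega), mul_neg_one, neg_neg, WithZero.exp_log h0]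

/-- **THE TWO SMALLEST OF `v(a−b), v(c−b), v(a−c)` AGREE** (exponent form; ★ `flicker_theorem15`'s tag `h`): with `|a−b| = |ϖ^{N₁}|`, `|c−b| = |ϖ^{N₂}|`, `|a−c| = |ϖ^N|`,
`(N₁ = N₂ ∧ N₁ ≤ N) ∨ (N₁ = N ∧ N₁ ≤ N₂) ∨ (N₂ = N ∧ N₂ ≤ N₁)` — `a − c = (a − b) − (c − b)` and the valuation is non-archimedean. [cite: Flicker1998UnitaryFL, §6 p. 95] -/
theorem flickerSum_two_smallest_eq {ϖ : K} (hϖ0 : 0 < Valued.v ϖ) (hϖ1 : Valued.v ϖ < 1) {a b c : K} {N N₁ N₂ : ℕ}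
    (hN : Valued.v (a - c) = Valued.v (ϖ ^ N)) (hN₁ : Valued.v (a - b) = Valued.v (ϖ ^ N₁)) (hN₂ : Valued.v (c - b) = Valued.v (ϖ ^ N₂)) :
    (N₁ = N₂ ∧ N₁ ≤ N) ∨ (N₁ = N ∧ N₁ ≤ N₂) ∨ (N₂ = N ∧ N₂ ≤ N₁) := by
  have hmono : StrictAnti (fun n : ℕ => Valued.v ϖ ^ n) := pow_right_strictAnti₀ hϖ0 hϖ1
  simp only [map_pow] at hN hN₁ hN₂
  have e : a - c = (a - b) - (c - b) := by ring
  rcases lt_trichotomy N₁ N₂ with h12 | h12 | h12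
  · -- `|a−b| > |c−b|` ⇒ `|a−c| = |a−b|`
    have hlt : Valued.v (c - b) < Valued.v (a - b) := by rw [hN₁, hN₂]; exact hmono h12
    have h : Valued.v (a - c) = Valued.v ϖ ^ N₁ := by rw [e, Valued.v.map_sub_eq_of_lt_left hlt, hN₁]
    exact Or.inr (Or.inl ⟨(hmono.injective (hN.symm.trans h)).symm, h12.le⟩)
  · subst h12
    refine Or.inl ⟨rfl, ?_⟩
    have hle : Valued.v ϖ ^ N ≤ Valued.v ϖ ^ N₁ := by
      rw [← hN, e]
      refine (Valuation.map_sub _ _ _).trans (max_le ?_ ?_)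
      · rw [hN₁]
      · rw [hN₂]
    by_contra hcon
    exact lt_irrefl _ ((hmono (Nat.lt_of_not_le hcon)).trans_le hle)
  · have hlt : Valued.v (a - b) < Valued.v (c - b) := by rw [hN₁, hN₂]; exact hmono h12
    have h : Valued.v (a - c) = Valued.v ϖ ^ N₂ := by rw [e, Valued.v.map_sub_eq_of_lt_right hlt, hN₂]
    exact Or.inr (Or.inr ⟨(hmono.injective (hN.symm.trans h)).symm, h12.le⟩)

/-- **THE `φ₁`-SLOT LEMMA**: under ★ FILE 0 (H.3)'s case tag `(N₁ < N ∧ N₂ = N₁ ∧ N₊ = N₁) ∨ (N ≤ N₁ ∧ N ≤ N₊)`, `φ₁(q; N₊, N) = φ₁(q; N₁, N)` — the ★ Flicker closed form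
`phiOne q X N` reads `X` only in the branch `N > X`. [cite: Flicker1998UnitaryFL, Prop. 11 p. 87] -/
theorem phiOne_eq_of_caseTag (q : ℕ) {N Np N₁ N₂ : ℕ} (h : (N₁ < N ∧ N₂ = N₁ ∧ Np = N₁) ∨ (N ≤ N₁ ∧ N ≤ Np)) :
    phiOne q Np N = phiOne q N₁ N := by
  rcases h with ⟨-, -, rfl⟩ | ⟨h1, h2⟩
  · rfl
  · rw [phiOne, phiOne, if_pos h2, if_pos h1]

end Letters

/-! ## §5 `#Ball(x₀, N) = φ_H(q, N)` on the `(q+1)`-regular tree, and `Φ = #Fix(δ₁) = φ_H(q, N)` -/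

section Ball

variable {V : Type*} {G : SimpleGraph V}

/-- **`#Ball(x₀, N) = φ_H(q, N) = (q^N(q+1) − 2)∕(q−1)`** on a tree with finite neighbour sets of constant valency `q + 1` (`1 < q`): the ball is the disjoint union of the
spheres `#S(0) = 1`, `#S(m) = (q+1)q^{m−1}` (★ A0 `ncard_sphere_eq_of_regular_tree`) and `φ_H(N) − φ_H(N−1) = q^{N−1}(q+1)` (★ `phiH_sub_phiH_pred`).
[cite: Serre1980Trees, I.2.3 Ex. 2] [cite: Flicker1998UnitaryFL, §6 p. 95] -/
theorem ncard_ball_eq_phiH (hT : G.IsTree) (x₀ : V) (hnb : ∀ v, (G.neighborSet v).Finite) {q : ℕ} (hq : 1 < q)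
    (hdeg : ∀ v, (G.neighborSet v).ncard = q + 1) (N : ℕ) :
    (({v | G.dist x₀ v ≤ N}.ncard : ℕ) : ℚ) = phiH q N := by
  induction N with
  | zero =>
    have hset : {v | G.dist x₀ v ≤ 0} = {x₀} := by
      ext v
      simp only [Set.mem_setOf_eq, Nat.le_zero, Set.mem_singleton_iff, hT.connected.dist_eq_zero_iff]
      exact eq_comm
    have hq1 : (q : ℚ) - 1 ≠ 0 := sub_ne_zero.2 (by exact_mod_cast (ne_of_gt hq))
    rw [hset, Set.ncard_singleton, phiH, pow_zero, one_mul, Nat.cast_one]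
    field_simp
    ring
  | succ N ih =>
    have hsplit : {v | G.dist x₀ v ≤ N + 1} = {v | G.dist x₀ v ≤ N} ∪ {v | G.dist x₀ v = N + 1} := by
      ext v
      simp only [Set.mem_setOf_eq, Set.mem_union]
      omega
    have hdisj : Disjoint {v | G.dist x₀ v ≤ N} {v | G.dist x₀ v = N + 1} :=
      Set.disjoint_left.2 fun v (hv : G.dist x₀ v ≤ N) (hv' : G.dist x₀ v = N + 1) => by omega
    have hfinB : {v | G.dist x₀ v ≤ N}.Finite := ClosedBall.finite_setOf_dist_le hnb hT.connected x₀ N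
    have hfinS : {v | G.dist x₀ v = N + 1}.Finite :=
      (ClosedBall.finite_setOf_dist_le hnb hT.connected x₀ (N + 1)).subset fun v (hv : G.dist x₀ v = N + 1) => by
        show G.dist x₀ v ≤ N + 1; omega
    rw [hsplit, Set.ncard_union_eq hdisj hfinB hfinS, Nat.cast_add, ih, ncard_sphere_eq_of_regular_tree hT x₀ hnb q hdeg (by omega),
      Nat.add_sub_cancel]
    have h := phiH_sub_phiH_pred hq (N := N + 1) (by omega)
    rw [Nat.add_sub_cancel] at h
    push_cast
    linear_combination -h

variable {K : Type} [Field K] [Valued K ℤᵐ⁰] [ValuativeRel K] [(Valued.v : Valuation K ℤᵐ⁰).Compatible] {σ : K →+* K} {ϖ : K}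

/-- **`Φ = #Fix_{X₂}(δ₁) = φ_H(q, N)`** for the `{0,2}`-compression `δ₁` of Flicker's `t_1(a,b,c)` with `|a − c| = |ϖ^N|`, on the `(q+1)`-regular tree `X₂`
(★ FILE 1a `setOf_compression_fixed_eq_ball`: `Fix δ₁ = Ball(x₀, N)`; then `ncard_ball_eq_phiH`). [cite: Flicker1998UnitaryFL, §6 p. 95] [cite: Rogawski1990, §4.9 pp. 54–55] -/
theorem ncard_compression_fixed_eq_phiH (hd : HermitianLattice.UnramifiedLocalConjDatum σ ϖ) (h2 : Valued.v (2 : K) = 1)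
    {e a c : K} (h2e : 2 * e = 1) (ha : σ a * a = 1) (hc : σ c * c = 1) {N : ℕ} (hN : Valued.v (a - c) = Valued.v (ϖ ^ N))
    (δ : unitaryGroupOfForm σ ((StdForm.antidiagonal 2).over K))
    (hδ : ((δ : GL (Fin 2) K) : Matrix (Fin 2) (Fin 2) K) = !![e * (a + c), -(e * (a - c)); -(e * (a - c)), e * (a + c)])
    (x₀ : {M : Submodule (ValuativeRel.valuation K).integer (Fin 2 → K) // HermitianLatticeTree.IsSpecialLattice σ ϖ ((StdForm.antidiagonal 2).over K) M})
    (hx₀ : x₀.1 = HermitianLatticeTree.latt (1 : Matrix (Fin 2) (Fin 2) K))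
    (hloc : ∀ v, ((HermitianLatticeTree.latticeTree σ ϖ ((StdForm.antidiagonal 2).over K)).neighborSet v).Finite) {q : ℕ} (hq : 1 < q)
    (hreg : ∀ v, ((HermitianLatticeTree.latticeTree σ ϖ ((StdForm.antidiagonal 2).over K)).neighborSet v).ncard = q + 1) :
    (({v | HermitianLatticeTree.latticeTreeIso σ ϖ ((StdForm.antidiagonal 2).over K) δ v = v}.ncard : ℕ) : ℚ) = phiH q N := by
  have hn : Valued.v (a - c) = WithZero.exp (-(N : ℤ)) := by
    rw [hN, map_pow, hd.vϖ, ← WithZero.exp_nsmul, nsmul_eq_mul, mul_neg_one]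
  haveI := isDiscreteValuationRing_integer_of_compatible hd.vϖ
  have hT := HermitianLatticeTree.isTree_latticeTree σ (valuation_map_eq_of_datum hd) (isUniformizingElement_of_v_eq hd.vϖ)
    (isUnimodular₂_antidiagonal_two (K := K))
  rw [setOf_compression_fixed_eq_ball hd h2 h2e ha hc hn δ hδ x₀ hx₀]
  exact ncard_ball_eq_phiH hT x₀ hloc hq hreg N

end Ball

end Summit.HodgeConjecture.HodgeConjecture.R90.S6

end
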